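import Literature.NumberTheory.GaloisRepresentations.IdeleLocalInvariantsCanonical
import Literature.NumberTheory.GaloisRepresentations.LocalCanonicalFundamentalClassRestriction
import Literature.NumberTheory.GaloisRepresentations.SemiLocalUnitGroupBaseChange
import Literature.NumberTheory.GaloisRepresentations.IdeleCohomologySubgroups
import Literature.NumberTheory.NumberFields.CompletionLocalDegree
import HarnessLib

/-!
# Restriction of the idèle local invariants along a tower `F ⊆ K ⊆ E`:
# `inv_{v'}(Res_{Gal(E/K)} c) = [K_{v'} : F_v] · inv_v(c)` on `H²(Gal(E/F), J_E)` (Tate, C–F VII §9.7 (15))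

Topic `NumberTheory/GaloisRepresentations`; namespaces `Literature.NumberTheory.GaloisRepresentations.SemiLocal`
(the semi-local module under restriction) and `….IdeleCohomology` (the idèle module), continuing
`IdeleLocalInvariants.lean` / `IdeleLocalInvariantsCanonical.lean` (`localInvAt w`, `localInv E v` — the local
invariant of a class of `H²(Gal(E/F), J_E)` at a finite place, independent of the place `w ∣ v` at which it is read),
`SemiLocalUnitGroupBaseChange.lean` (places in a tower: `Place.ofTower`, `towerResUnits`) and door-c6 g12's
`LocalCanonicalFundamentalClassRestriction.lean` (**`UnitsLayer.layerInv_unitsRes`**: for local fields `K ⊆ E` and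
`L/K` Galois, `inv_{L/E}(Res x) = [E:K] · inv_{L/K}(x)`).  Definitions with bodies (the restriction maps) and
theorems; NO named fact, no `sorry`, no instance, no notation; number fields in `Type`.

Mathematics (Tate, C–F VII §9.7, the functorial properties of `inv_v`): for finite Galois `E/F` with group
`G`, a subgroup `H = Gal(E/K)` and `α ∈ H²(G, J_E)`, formula (15) reads `inv_w(res^G_H α) = n_{w/v} inv_v(α)` with
`n_{w/v} = [K_w : F_v]` for a place `w` of `K` above `v` — "again one reduces immediately to the local case" —
and Tate adds that `K/F` need not be Galois.  The reduction: restriction commutes with the projection to the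
`v`-block, `J_E → ∏_{w ∣ v} E_wˣ`, and the `Gal(E/K)`-module `∏_{w ∣ v} E_wˣ` is the product over the places
`v' ∣ v` of `K` of the blocks `∏_{w ∣ v'} E_wˣ` (§1); Shapiro's isomorphism `Hⁿ(G, ∏_{w∣v} E_wˣ) ≅ Hⁿ(Gal(E_w/F_v), E_wˣ)`
is restriction to the decomposition group followed by the `w`-projection, so under restriction to `Gal(E/K)` it
becomes the LOCAL restriction `Hⁿ(Gal(E_w/F_v), E_wˣ) → Hⁿ(Gal(E_w/K_{v'}), E_wˣ)` of the tower of completions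
`F_v ⊆ K_{v'} ⊆ E_w` (§2, `groupCohomologyUnitsRepIsoAut_hom_map_towerUnitsBlock`); the local statement is
door-c6's `layerInv_unitsRes` (§3).

## What is formalised (`F K E : Type` number fields, `IsScalarTower F K E`, `E/F` Galois where marked,
## `v : HeightOneSpectrum (𝓞 F)`, `v' : Place F K v`, `w : Place K E v'`)

* §1 `SemiLocal.towerUnitsBlock v' : Res_{Gal(E/K)} (∏_{w∣v} E_w)ˣ ⟶ (∏_{w∣v'} E_w)ˣ` (restriction of unit
  families to the places above `v'`, a morphism of `Gal(E/K)`-modules), its components.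
* §2 **`SemiLocal.groupCohomologyUnitsRepIsoAut_hom_map_towerUnitsBlock`**: for `y ∈ Hⁿ(Gal(E/F), ∏_{w∣v} E_wˣ)`,
  `Sh^{E/K}_w (Hⁿ(Res)(y)) = Res_{F_v ⊆ K_{v'}} (Sh^{E/F}_w y)` in `Hⁿ(Gal(E_w/K_{v'}), E_wˣ)` (door-c6's `unitsRes`
  of the local tower).
* §3 `IdeleCohomology.ideleResHom`, **`ideleRes F K E n : Hⁿ(Gal(E/F), J_E) ⟶ Hⁿ(Gal(E/K), J_E)`** (restriction;
  the restricted module IS the idèle module of `E/K`, `res_restrictScalarsHom_ideleRep`),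
  `res_placeProj_comp_towerUnitsBlock` (restriction commutes with the block projections),
  `map_placeProj_ideleRes`; **`localInvAt_ideleRes`**: `inv^{E/K}_{w}(Res c) = [K_{v'} : F_v] · inv^{E/F}_{w}(c)`
  (Tate (15)); **`localInv_ideleRes`**: `localInv E v' (Res c) = [K_{v'} : F_v] · localInv E v c`.

Not here: the sum over `v' ∣ v` (`∑_{v'∣v} [K_{v'}:F_v] = [K:F]`, Tate §11.2 (7)) and the infinite places;
corestriction (Tate (16)).

## References
* J. W. S. Cassels, A. Fröhlich (eds.), *Algebraic Number Theory* (1967), Ch. VII (J. Tate) §9.7 formula (15),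
  §7.2–§7.3. [CasselsFrohlichANT1967]
* J.-P. Serre, *Local Fields*, GTM 67 (1979), Ch. XIII §3 Prop. 7; Ch. XI §3. [SerreLocalFields1979]
-/

noncomputable section

open NumberField IsDedekindDomain CategoryTheory groupCohomology
open Literature.NumberTheory.Automorphic

namespace Literature.NumberTheory.GaloisRepresentations

/-! ## §1. The semi-local module under restriction to `Gal(E/K)`: the block at `v' ∣ v` -/

namespace SemiLocal

open Literature.Algebra.Homology Literature.NumberTheory.NumberFields

section Tower

variable {F K E : Type} [Field F] [Field K] [Field E] [NumberField F] [NumberField K] [NumberField E]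
  [Algebra F K] [Algebra K E] [Algebra F E] [IsScalarTower F K E]
variable {v : HeightOneSpectrum (𝓞 F)}

/-- **The block at `v' ∣ v`: `Res_{Gal(E/K)} (∏_{w∣v} E_w)ˣ ⟶ (∏_{w∣v'} E_w)ˣ`**, restriction of a family of local
units to the places of `E` above the place `v'` of `K` — a morphism of `Gal(E/K)`-modules (`towerRes_smul`).
[cite: CasselsFrohlichANT1967, Ch. VII §7.3] -/
def towerUnitsBlock (v' : Place F K v) :
    Rep.res (AlgEquiv.restrictScalarsHom F : (E ≃ₐ[K] E) →* (E ≃ₐ[F] E)) (unitsRep F E v) ⟶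
      unitsRep K E (v' : HeightOneSpectrum (𝓞 K)) :=
  Rep.ofHom ⟨(MonoidHom.toAdditive (towerResUnits v')).toIntLinearMap, fun σ => LinearMap.ext fun x => by
    apply Additive.toMul.injective
    apply Units.ext
    exact towerRes_smul v' σ (((Additive.toMul x : (SemiLocal F E v)ˣ)) : SemiLocal F E v)⟩

/-- Components of `towerUnitsBlock`: the `w`-component (`w ∣ v'`) is the `w`-component (`w ∣ v`).
[cite: CasselsFrohlichANT1967, Ch. VII §7.3] -/
theorem val_toMul_towerUnitsBlock_apply (v' : Place F K v) (x : Additive (SemiLocal F E v)ˣ)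
    (w : Place K E (v' : HeightOneSpectrum (𝓞 K))) :
    ((Additive.toMul ((towerUnitsBlock v').hom x) : (SemiLocal K E (v' : HeightOneSpectrum (𝓞 K)))ˣ) :
        SemiLocal K E (v' : HeightOneSpectrum (𝓞 K))) w =
      ((Additive.toMul x : (SemiLocal F E v)ˣ) : SemiLocal F E v) (Place.ofTower w) := rfl

/-! ## §2. Shapiro under restriction: `Sh^{E/K}_w ∘ Res = Res_{F_v ⊆ K_{v'}} ∘ Sh^{E/F}_w` -/

/-- An element of `Gal(E/K)` fixing the place `w` of `E` (above `v'`) fixes it as a place above `v`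
(`(σ|_F) • w = σ • w` on `HeightOneSpectrum (𝓞 E)`). [cite: CasselsFrohlichANT1967, Ch. VII §1.1] -/
theorem restrictScalarsHom_mem_stabilizer_ofTower {v' : Place F K v} {w : Place K E (v' : HeightOneSpectrum (𝓞 K))}
    (h : MulAction.stabilizer (E ≃ₐ[K] E) w) :
    AlgEquiv.restrictScalarsHom F (h : E ≃ₐ[K] E) ∈ MulAction.stabilizer (E ≃ₐ[F] E) (Place.ofTower w) := by
  rw [MulAction.mem_stabilizer_iff]
  exact Place.ext (coe_stabilizer_smul w h)

/-- **The tower of completions `F_v ⊆ K_{v'} ⊆ E_w` is a scalar tower** for the tree's local base-change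
structures (`SemiLocal.algebraPlace`; the `F_v`-structure of `E_w` is that of `w` as a place above `v`,
`Place.ofTower w`) — the tree's `isScalarTower_place_tower`, restated for `Place.ofTower`.
[cite: CasselsFrohlichANT1967, Ch. II §10] -/
theorem isScalarTower_ofTower (v' : Place F K v) (w : Place K E (v' : HeightOneSpectrum (𝓞 K))) :
    letI : Algebra (v.adicCompletion F) ((w : HeightOneSpectrum (𝓞 E)).adicCompletion E) :=
      algebraPlace (Place.ofTower w)
    IsScalarTower (v.adicCompletion F) ((v' : HeightOneSpectrum (𝓞 K)).adicCompletion K)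
      ((w : HeightOneSpectrum (𝓞 E)).adicCompletion E) := by
  haveI : ((w : HeightOneSpectrum (𝓞 E))).asIdeal.LiesOver v.asIdeal := Place.liesOver (Place.ofTower w)
  exact isScalarTower_place_tower v' w

/-- **The decomposition isomorphisms in the tower**: for `h ∈ Stab_{Gal(E/K)}(w)`, the `F_v`-automorphism
`(h|_F)_w` of `E_w` (`decompMulEquiv (Place.ofTower w)`) is the `K_{v'}`-automorphism `h_w` (`decompMulEquiv w`) with
scalars restricted to `F_v` — both are the continuous extension of `h` to `E_w`.
[cite: CasselsFrohlichANT1967, Ch. VII §1.1] -/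
theorem decompMulEquiv_ofTower_restrictScalarsHom [IsGalois F E] {v' : Place F K v}
    {w : Place K E (v' : HeightOneSpectrum (𝓞 K))} (h : MulAction.stabilizer (E ≃ₐ[K] E) w) :
    haveI : IsGalois K E := IsGalois.tower_top_of_isGalois F K E
    letI : Algebra (v.adicCompletion F) ((w : HeightOneSpectrum (𝓞 E)).adicCompletion E) :=
      algebraPlace (Place.ofTower w)
    haveI := isScalarTower_ofTower v' w
    decompMulEquiv (Place.ofTower w) ⟨AlgEquiv.restrictScalarsHom F (h : E ≃ₐ[K] E),
        restrictScalarsHom_mem_stabilizer_ofTower h⟩ =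
      (decompMulEquiv w h).restrictScalars (v.adicCompletion F) := by
  haveI : IsGalois K E := IsGalois.tower_top_of_isGalois F K E
  apply AlgEquiv.ext
  intro x
  rw [decompMulEquiv_apply, decompAlgEquiv_apply]
  rfl

/-- **Shapiro under restriction** (Tate VII §9.7: "one reduces immediately to the local case").  For
`y ∈ Hⁿ(Gal(E/F), ∏_{w∣v} E_wˣ)`, restricting to `Gal(E/K)` and projecting to the block at `v' ∣ v`, then applying the
Shapiro isomorphism of `E/K` at `w ∣ v'`, gives the LOCAL restriction (door-c6's `UnitsLayer.unitsRes` for the tower of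
completions `F_v ⊆ K_{v'} ⊆ E_w`) of the Shapiro image of `y` for `E/F` at `w`:
`Sh^{E/K}_w (Hⁿ(Res)(y)) = Res_{Gal(E_w/K_{v'}) ↪ Gal(E_w/F_v)} (Sh^{E/F}_w y)`.  Both sides are `Hⁿ` of one morphism of
pairs `(Gal(E_w/K_{v'}), E_wˣ) → (Gal(E/F), ∏_{w∣v} E_wˣ)` (Shapiro = restriction to the decomposition group + the
`w`-projection, `groupCohomologyUnitsRepIso_hom_eq`). [cite: CasselsFrohlichANT1967, Ch. VII §9.7 (15)] -/
theorem groupCohomologyUnitsRepIsoAut_hom_map_towerUnitsBlock [IsGalois F E] (v' : Place F K v)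
    (w : Place K E (v' : HeightOneSpectrum (𝓞 K))) (n : ℕ) (y : groupCohomology (unitsRep F E v) n) :
    haveI : IsGalois K E := IsGalois.tower_top_of_isGalois F K E
    letI : Algebra (v.adicCompletion F) ((w : HeightOneSpectrum (𝓞 E)).adicCompletion E) :=
      algebraPlace (Place.ofTower w)
    haveI := isScalarTower_ofTower v' w
    (groupCohomologyUnitsRepIsoAut w n).hom
        (groupCohomology.map (AlgEquiv.restrictScalarsHom F) (towerUnitsBlock v') n y) =
      UnitsLayer.unitsRes (v.adicCompletion F) ((v' : HeightOneSpectrum (𝓞 K)).adicCompletion K)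
        ((w : HeightOneSpectrum (𝓞 E)).adicCompletion E) n
        ((groupCohomologyUnitsRepIsoAut (Place.ofTower w) n).hom y) := by
  haveI : IsGalois K E := IsGalois.tower_top_of_isGalois F K E
  letI : Algebra (v.adicCompletion F) ((w : HeightOneSpectrum (𝓞 E)).adicCompletion E) :=
    algebraPlace (Place.ofTower w)
  haveI := isScalarTower_ofTower v' w
  have key : groupCohomology.map (AlgEquiv.restrictScalarsHom F) (towerUnitsBlock v') n ≫
      (groupCohomologyUnitsRepIsoAut w n).hom =
    (groupCohomologyUnitsRepIsoAut (Place.ofTower w) n).hom ≫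
      UnitsLayer.unitsRes (v.adicCompletion F) ((v' : HeightOneSpectrum (𝓞 K)).adicCompletion K)
        ((w : HeightOneSpectrum (𝓞 E)).adicCompletion E) n := by
    rw [groupCohomologyUnitsRepIsoAut, groupCohomologyUnitsRepIsoAut, Iso.trans_hom, Iso.trans_hom,
      groupCohomologyUnitsRepIso_hom_eq, groupCohomologyUnitsRepIso_hom_eq, groupCohomologyLocalUnitsRepIso,
      groupCohomologyLocalUnitsRepIso, groupCohomology.mapIso_hom, groupCohomology.mapIso_hom, UnitsLayer.unitsRes,
      ← groupCohomology.map_comp, ← groupCohomology.map_comp, ← groupCohomology.map_comp]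
    -- the last composition is across the (definitional) identification `E_{(w : place over v)} = E_w`
    erw [← groupCohomology.map_comp]
    refine map_congr' ?_ _ _ (fun a => ?_) n
    · -- the two routes `Gal(E_w/K_{v'}) → Gal(E/F)` agree
      refine MonoidHom.ext fun s => ?_
      obtain ⟨h, rfl⟩ := (decompMulEquiv w).surjective s
      change AlgEquiv.restrictScalarsHom F (((decompMulEquiv w).symm (decompMulEquiv w h) :
          MulAction.stabilizer (E ≃ₐ[K] E) w) : E ≃ₐ[K] E) =
        (((decompMulEquiv (Place.ofTower w)).symm
          ((decompMulEquiv w h).restrictScalars (v.adicCompletion F)) :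
            MulAction.stabilizer (E ≃ₐ[F] E) (Place.ofTower w)) : E ≃ₐ[F] E)
      rw [MulEquiv.symm_apply_apply, ← decompMulEquiv_ofTower_restrictScalarsHom h, MulEquiv.symm_apply_apply]
    · -- the two module maps agree: the `w`-component
      rfl
  exact congrArg (fun φ => φ.hom y) key

end Tower

end SemiLocal

/-! ## §3. Restriction on `H²(Gal(E/F), J_E)` and the local invariants -/

namespace IdeleCohomology

open Literature.Algebra.Homology Literature.NumberTheory.NumberFields SemiLocal

section Tower

variable {F K E : Type} [Field F] [Field K] [Field E] [NumberField F] [NumberField K] [NumberField E]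
  [Algebra F K] [Algebra K E] [Algebra F E] [IsScalarTower F K E]
variable {v : HeightOneSpectrum (𝓞 F)}

variable (F K E) in
/-- **The identity `J_E → J_E` as a morphism `Res_{Gal(E/K) → Gal(E/F)} J_E ⟶ J_E`** of `Gal(E/K)`-modules (the
restricted module is the idèle module of `E/K`, `res_restrictScalarsHom_ideleRep`).
[cite: CasselsFrohlichANT1967, Ch. VII §9.7] -/
def ideleResHom :
    Rep.res (AlgEquiv.restrictScalarsHom F : (E ≃ₐ[K] E) →* (E ≃ₐ[F] E)) (IdeleClassGroup.ideleRep F E) ⟶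
      IdeleClassGroup.ideleRep K E :=
  Rep.ofHom ⟨LinearMap.id, fun _ => LinearMap.ext fun _ => rfl⟩

omit [NumberField F] [NumberField K] in
/-- Unfolding: `ideleResHom` is the identity on elements. [cite: CasselsFrohlichANT1967, Ch. VII §9.7] -/
@[simp] theorem ideleResHom_hom_apply (x : (IdeleClassGroup.ideleRep F E).V) : (ideleResHom F K E).hom x = x := rfl

variable (F K E) in
/-- **Restriction `Res : Hⁿ(Gal(E/F), J_E) ⟶ Hⁿ(Gal(E/K), J_E)`** along `Gal(E/K) → Gal(E/F)`, `σ ↦ σ|_F`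
(Mathlib `groupCohomology.map`; Tate's `res^G_H` on `H²(G, J_L)`). [cite: CasselsFrohlichANT1967, Ch. VII §9.7 (15)] -/
def ideleRes (n : ℕ) :
    groupCohomology (IdeleClassGroup.ideleRep F E) n ⟶ groupCohomology (IdeleClassGroup.ideleRep K E) n :=
  groupCohomology.map (AlgEquiv.restrictScalarsHom F) (ideleResHom F K E) n

/-- **Restriction commutes with the block projections**: on `Res_{Gal(E/K)} J_E`, projecting to the block
`∏_{w∣v} E_wˣ` and then to its `v'`-part is the block projection of the idèle module of `E/K` at `v'`.
[cite: CasselsFrohlichANT1967, Ch. VII §7.3] -/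
theorem res_placeProj_comp_towerUnitsBlock (v' : Place F K v) :
    (Rep.resFunctor (AlgEquiv.restrictScalarsHom F : (E ≃ₐ[K] E) →* (E ≃ₐ[F] E))).map (placeProj v) ≫
        towerUnitsBlock v' =
      ideleResHom F K E ≫ placeProj (F := K) (E := E) (v' : HeightOneSpectrum (𝓞 K)) := by
  refine Rep.hom_ext (Representation.IntertwiningMap.ext (LinearMap.ext fun x => ?_))
  apply Additive.toMul.injective
  exact Units.ext (funext fun w => rfl)

/-- **`Hⁿ(placeProj v')(Res c) = Hⁿ(Res)(Hⁿ(placeProj v)(c))`**: the `v'`-component of the restricted class is the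
restriction-to-the-block of the `v`-component. [cite: CasselsFrohlichANT1967, Ch. VII §9.7] -/
theorem map_placeProj_ideleRes (v' : Place F K v) (n : ℕ) (c : groupCohomology (IdeleClassGroup.ideleRep F E) n) :
    groupCohomology.map (MonoidHom.id (E ≃ₐ[K] E)) (placeProj (F := K) (E := E) (v' : HeightOneSpectrum (𝓞 K))) n
        (ideleRes F K E n c) =
      groupCohomology.map (AlgEquiv.restrictScalarsHom F) (towerUnitsBlock v') n
        (groupCohomology.map (MonoidHom.id (E ≃ₐ[F] E)) (placeProj v) n c) := by
  have key : ideleRes F K E n ≫ groupCohomology.map (MonoidHom.id (E ≃ₐ[K] E))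
      (placeProj (F := K) (E := E) (v' : HeightOneSpectrum (𝓞 K))) n =
    groupCohomology.map (MonoidHom.id (E ≃ₐ[F] E)) (placeProj v) n ≫
      groupCohomology.map (AlgEquiv.restrictScalarsHom F) (towerUnitsBlock v') n := by
    rw [ideleRes, ← groupCohomology.map_comp, ← groupCohomology.map_comp]
    refine map_congr' ?_ _ _ (fun x => ?_) n
    · ext σ; rfl
    · apply Additive.toMul.injective
      exact Units.ext (funext fun w => rfl)
  exact congrArg (fun φ => φ.hom c) key

/-- `K_{v'}` is finite-dimensional over `F_v` (it embeds `F_v`-linearly in `E_w`, finite over `F_v`).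
[cite: CasselsFrohlichANT1967, Ch. II §10] -/
theorem finiteDimensional_place_tower [IsGalois F E] (v' : Place F K v)
    (w : Place K E (v' : HeightOneSpectrum (𝓞 K))) :
    FiniteDimensional (v.adicCompletion F) ((v' : HeightOneSpectrum (𝓞 K)).adicCompletion K) := by
  letI : Algebra (v.adicCompletion F) ((w : HeightOneSpectrum (𝓞 E)).adicCompletion E) :=
    algebraPlace (Place.ofTower w)
  haveI := isScalarTower_ofTower v' w
  haveI : FiniteDimensional (v.adicCompletion F) ((w : HeightOneSpectrum (𝓞 E)).adicCompletion E) :=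
    finiteDimensional_place (K := F) (Place.ofTower w)
  exact FiniteDimensional.of_injective
    (IsScalarTower.toAlgHom (v.adicCompletion F) ((v' : HeightOneSpectrum (𝓞 K)).adicCompletion K)
      ((w : HeightOneSpectrum (𝓞 E)).adicCompletion E)).toLinearMap
    (algebraMap ((v' : HeightOneSpectrum (𝓞 K)).adicCompletion K) ((w : HeightOneSpectrum (𝓞 E)).adicCompletion E)).injective

/-- **Tate VII §9.7 (15): `inv_w(res^G_H α) = n_{w/v} · inv_v(α)`.**  For a tower `F ⊆ K ⊆ E` of number fields
with `E/F` Galois, a class `c ∈ H²(Gal(E/F), J_E)`, a place `v'` of `K` above `v` and a place `w` of `E` above `v'`: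
the local invariant of `Res_{Gal(E/K)} c` at `v'` (read at `w`) is `[K_{v'} : F_v]` times the local invariant of
`c` at `v` (read at the same `w`).  Proof: §2 and door-c6's local formula `inv_{L/E}(Res x) = [E:K] · inv_{L/K}(x)`
(`UnitsLayer.layerInv_unitsRes`) for the tower of completions `F_v ⊆ K_{v'} ⊆ E_w`.
[cite: CasselsFrohlichANT1967, Ch. VII §9.7 (15)][cite: SerreLocalFields1979, Ch. XIII §3 Prop. 7] -/
theorem localInvAt_ideleRes [IsGalois F E] (v' : Place F K v) (w : Place K E (v' : HeightOneSpectrum (𝓞 K)))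
    (c : groupCohomology (IdeleClassGroup.ideleRep F E) 2) :
    haveI : IsGalois K E := IsGalois.tower_top_of_isGalois F K E
    localInvAt w (ideleRes F K E 2 c) =
      Module.finrank (v.adicCompletion F) ((v' : HeightOneSpectrum (𝓞 K)).adicCompletion K) •
        localInvAt (Place.ofTower w) c := by
  haveI : IsGalois K E := IsGalois.tower_top_of_isGalois F K E
  letI : Algebra (v.adicCompletion F) ((w : HeightOneSpectrum (𝓞 E)).adicCompletion E) :=
    algebraPlace (Place.ofTower w)
  haveI := isScalarTower_ofTower v' w
  haveI : CharZero (v.adicCompletion F) := charZero_of_injective_algebraMap (algebraMap F _).injective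
  haveI : CharZero ((v' : HeightOneSpectrum (𝓞 K)).adicCompletion K) :=
    charZero_of_injective_algebraMap (algebraMap K _).injective
  haveI := finiteDimensional_place_tower v' w
  haveI : FiniteDimensional (v.adicCompletion F) ((w : HeightOneSpectrum (𝓞 E)).adicCompletion E) :=
    finiteDimensional_place (K := F) (Place.ofTower w)
  haveI : IsGalois (v.adicCompletion F) ((w : HeightOneSpectrum (𝓞 E)).adicCompletion E) :=
    isGalois_place (F := F) (Place.ofTower w)
  rw [localInvAt_apply, localInvAt_apply, map_placeProj_ideleRes,
    groupCohomologyUnitsRepIsoAut_hom_map_towerUnitsBlock]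
  exact UnitsLayer.layerInv_unitsRes (v.adicCompletion F) ((v' : HeightOneSpectrum (𝓞 K)).adicCompletion K)
    ((w : HeightOneSpectrum (𝓞 E)).adicCompletion E) _

/-- **`localInv E v' (Res c) = [K_{v'} : F_v] · localInv E v c`** — Tate (15) for the canonical local invariants
(`localInv` is `localInvAt` at any place above, `localInv_eq_localInvAt`).
[cite: CasselsFrohlichANT1967, Ch. VII §9.7 (15)] -/
theorem localInv_ideleRes [IsGalois F E] (v' : Place F K v) (c : groupCohomology (IdeleClassGroup.ideleRep F E) 2) :
    haveI : IsGalois K E := IsGalois.tower_top_of_isGalois F K E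
    localInv E (v' : HeightOneSpectrum (𝓞 K)) (ideleRes F K E 2 c) =
      Module.finrank (v.adicCompletion F) ((v' : HeightOneSpectrum (𝓞 K)).adicCompletion K) • localInv E v c := by
  haveI : IsGalois K E := IsGalois.tower_top_of_isGalois F K E
  obtain ⟨w⟩ := (Place.nonempty : Nonempty (Place K E (v' : HeightOneSpectrum (𝓞 K))))
  rw [localInv_eq_localInvAt w, localInv_eq_localInvAt (Place.ofTower w), localInvAt_ideleRes]

end Tower

end IdeleCohomology

end Literature.NumberTheory.GaloisRepresentations

end
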